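import Summits.QuantumFields.YangMills.Theorems.BalabanUVNodesN16Thm1AtTorusVPSmallCubesPrep
import Summits.QuantumFields.BalabanUV.T4Continuum.Support.MinimalActionDictionary
import Summits.QuantumFields.BalabanUV.T4Continuum.Support.MinimalActionCompact
import Summits.QuantumFields.BalabanUV.Beta.ThinLoopHolonomy
import HarnessLib
/-!
# Route «BalabanUVNodes» (K3⁷ `SpineGivenEndpointR13SepCoPH`, stmt-QuantumFields-20544), DAG node N16 = NE3, in-edge N07 → N16 — THE SMALL-CUBE VACUITY IN EVERY RANK:
# for EVERY gauge group `U(N)`, `N ≥ 1`, the displayed binder «`∀ k, B11Thm1.Thm1At C (MinimalActionDictionary.torusVP d L N G (k+1))`» is unsatisfiable together with the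
# first-order (9)_{β₀=1} extraction interface — rank-generic edition (abelian twisted datum) of dag-n16-w2's `…N16Thm1AtTorusVPSmallCubes` (rank two)

Cell `pub-ymgap`, width seat `pub-ymgap-dag-n16-w5` (director-ym R399 (3a); live-lane word pub-ymgap INBOX l.29122; this file = dag-n16-w2 g4's OFFER (o3) «rank-N version of the
refutation», INBOX l.29714, claimed l.29847), generation 0.  `--kind proof --supports stmt-QuantumFields-20544 --as helper` (count-neutral).  `bears_on: R4∕N16 · edge N07 → N16`.
Part 1 of 2 (part 2 `…SmallCubesRankNRecord`: the parent's own gauge shape with NO hypothesis, the record's letters, `stub_thm1At` negated for every `N`).  Built BY NAME on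
dag-n16-w2's `…SmallCubesPrep` §1 `smallField_of_localGauges` (p607834), leaf-06's `Support/MinimalActionDictionary` (`torusVP`, `gauge_of_regularity`; divergence D-s3-3),
leaf-05's `Support/MinimalActionCompact.avgIter_unitary_smallField` (B7 Prop. 1∕2 transport) and `Beta/ThinLoopHolonomy.norm_hol_sub_one_le_length_mul`.

WHAT (the located reading is dag-n16-w2's, INBOX l.29224∕l.29714 and `…SmallCubes` header; found independently here while working the handed piece P2 «read `N16H7OfReg9` §3 on the
five-site cube»).  Leaf-06's instance `torusVP` reads Theorem 1's regularity clause (`B11Thm1.Reg910` ∘ `B11.Regularity`) on ALL lattice cubes `box K y` with the bound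
`B₃·sizeM·ε₁` PROPORTIONAL TO THE CUBE'S OWN size parameter `sizeM (y,K) = cubeM L j K = (2K+1)∕(2Lʲ)`; print's cubes are unions of big blocks, `M ∈ R₁M₁ℕ` ([Balaban1985Variational]
p. 279 L1–5).  On the five-site cube (`K = 2`, `cubeM = 5∕(2L^{k+1})`) the admissible common factor is one power of `L^{−(k+1)}` BELOW the class radius.  §1 (any nonempty `n`):
`exists_smallField_cfg_of_thm1At_smallCube` — under `hGm`∕`hG` and `Thm1At C (torusVP d L N G (k+1))` with the five-site cube admissible at `ε₁`, (8)'s minimiser over any datum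
`V ∈ sfClass d L N ε₁ 0` has ALL plaquettes within `2α₁ + ρ(4α₀)`, `α₀ = c∕L^{k+1}`, `α₁ = c∕L^{2(k+1)}`, `c = B₃·cubeM·ε₁` (`smallField_of_localGauges` BY NAME); hence
`smallField_datum_of_thm1At_smallCube` — THE DATUM ITSELF has all plaquettes within `2S∕L^{k+1}` of `1`, `S = 5B₃ε₁(1 + 20B₃ε₁)`, once `2·5B₃ε₁ ≤ L^{k+1}`, `16C₀S ≤ 3L^{k+1}`,
`1024(d+1)(d+4)L²S ≤ L^{k+1}`.  §2: `exists_twisted_datum` — for `d ≥ 2`, `N ≥ 2`, ANY `n` and any phase `θ`, the `N`-periodic configuration with the SCALAR `e^{iθ}·1` on the direction-0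
bonds over the hyperplanes `N ∣ x₁` lies in `sfClass d L N (4|θ|) 0` with a plaquette at distance EXACTLY `|e^{iθ} − 1| ≥ θ∕2` (`half_le_norm_exp_I_mul_sub_one`, `0 ≤ θ ≤ 1`).  §3:
★ `not_thm1At_torusVP_of_deep` (five explicit thresholds on `L^{k+1}`; `θ = min(a₁∕4, 1)`, `ε₁ = a₁`) · ★ `exists_forall_not_thm1At_torusVP` (`∃ k₀ ∀ k ≥ k₀ ¬ Thm1At …`, Archimedes) ·
★★ `not_forall_thm1At_torusVP_rankN`: for EVERY nonempty fintype `n`, `d ≥ 2`, `L ≥ 2`, torus factor `N ≥ 2`, every `C` and every radii-monotone `G` with the first-order interface,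
`¬ ∀ k, Thm1At C (torusVP d L N G (k+1))`.  Compared with dag-n16-w2's `N16Thm1AtTorusVPSmallCubes.not_forall_thm1At_torusVP` (n = `Fin 2`, constant `SU(2)` commutator datum, any
torus factor): the rank is now arbitrary (abelian `N = 1` included) at the price of `N ≥ 2` for the torus factor (the twist needs two distinct hyperplane classes).

CONSEQUENCE ∕ CAUSE ∕ REPAIR — dag-n16-w2's, unchanged (A6: the `(hGm, hG, hM, hT)` bundle of every (β16) loose-road producer — `N16H7OfReg9` §3, `N16H7LooseOfThm1At`, `N16InteriorOfCapture`
§2–§4, `N16PinnedLayer13CoPH` §4, `N16PinnedLooseMatch`, `…OfLettersB9Src` — is uninhabited, now for EVERY `[NeZero N]`, not only `N = 2`; cause = D-s3-3's size-proportional bound on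
sub-block cubes; repair C′ = Theorem 1's regularity on print's cube class only, e.g. `1 ≤ sizeM c`, which every existing big-cube proof meets (`cubeM_slot_le`: `M ∈ [2, 7∕2]`) and which this
witness (`sizeM = 5∕(2L^{k+1}) < 1`) MISSES).  The handed piece P2 («lower the binder `7∕2 ≤ M` to `5∕(2L)`») is WITHDRAWN by this seat: the five-site cube empties the interface.

HONEST FRAMING.  A refutation of a TREE READING, kernel facts BY NAME + one explicit scalar configuration; 0 `def`, 0 `sorry`.  [Balaban1985Variational] Theorem 1 AS PRINTED is neither
refuted nor proved (its cubes have `M ≥ R₁M₁`); no registered stub of K3⁷ v5 is named (`stub_rates13H` ∕ `stub_expansion13H` untouched); N16 ∕ N07 NOT discharged; count-neutral (typed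
28∕28 · discharged 5∕27 · A 5∕28 unmoved); one finite four-torus at fixed `ε`, Bałaban AS PRINTED — NOT ℝ⁴, NOT infinite volume, NOT OS, NOT a mass gap; the YM mass gap (Clay) is NOT
proved (nor disproved) by any of this — R4 closes the conditional finite-𝕋⁴ rung `BalabanLadder.UV` only.  Context: [Balaban1985Variational] (2)–(8) p. 278, Thm 1 (8)–(10) p. 279;
[Balaban1985Averaging] Props. 1–2 pp. 24–26.
-/

set_option autoImplicit false

open scoped BigOperators Matrix Matrix.Norms.L2Operator
open NormedSpace

namespace Summit.QuantumFields.YangMills.BalabanUVNodes.N16Thm1AtTorusVPSmallCubesRankN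

open Literature.MathematicalPhysics.QuantumFieldTheory.Balaban1983to89
open B7Prop1Explicit B7Prop2Explicit MatrixLog UnitaryModel
open T4AveragingDeficitWall hiding Site Plane Plaq Bond
open T4AveragingDeficitWallBoundary (IsPeriodicCfg)
open Summit.QuantumFields.BalabanUV.T4Continuum
open AveragingDeficitLatticeH2Prep (fd)
open AveragingDeficitTransport (mem_U1_of_unitary)
open AveragingDeficitFluxExpansion (norm_fhol_sub_one_le)
open MinimalActionSandwich (IsMinimiser)
open MinimalActionRate (sfClass)
open MinimalActionCompact (avgIter_unitary_smallField)
open MinimalActionDictionary (torusVP RadiiMono cubeM cubeM_pos gauge_of_regularity)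
open B11 (Regularity)
open B11Thm1 (Thm1At)
open Summit.QuantumFields.YangMills.BalabanUVNodes.N16Thm1AtTorusVPSmallCubesPrep (smallField_of_localGauges)
open Summit.QuantumFields.BalabanUV.Beta.ThinLoopHolonomy (norm_hol_sub_one_le_length_mul)

noncomputable section

variable {d : ℕ} {n : Type} [Fintype n] [DecidableEq n]

/-! ## §1 Theorem 1 at the torus instances, read on the five-site cube: the minimiser's and the datum's plaquettes -/

/-- **THE SMALL-CUBE READING.**  Under the interface binders `hGm`∕`hG` of `N16H7OfReg9` §3 (`L ≥ 1`): if [Balaban1985Variational] Theorem 1 holds at `C` for the torus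
instance of run `k+1` (`Thm1At C (torusVP d L N G (k+1))` — a DISPLAYED hypothesis) and the five-site cube fits Theorem 1's cube bound at `ε₁ ∈ (0, a₁]`
(`cubeM L (k+1) 2 = 5∕(2L^{k+1}) ≤ M(ε₁)`), then every datum `V ∈ sfClass d L N ε₁ 0` is the `(k+1)`-fold average of a `U(N)`-valued configuration ALL of whose plaquettes
lie within `2α₁ + ρ(4α₀)` of `1`, `α₀ = c∕L^{k+1}`, `α₁ = c∕L^{2(k+1)}`, `c = B₃·cubeM·ε₁ = 5B₃ε₁∕(2L^{k+1})` — namely (8)'s minimiser, whose regularity (9) on the cube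
`box 2 x` about EVERY site `x` (`Reg910` over all lattice cubes, leaf-06 D-s3-3) bounds the plaquette at `x` through §1.  Since `c` itself carries a factor `L^{−(k+1)}`,
the plaquettes of the minimiser are `O(ε₁ L^{−3(k+1)})`, one order below the class radius `B₃ε₁L^{−2(k+1)}`. [cite: Balaban1985Variational, Thm 1 (8)–(10) p.279] -/
theorem exists_smallField_cfg_of_thm1At_smallCube [Nonempty n] {L N : ℕ} (hL : 1 ≤ L)
    {G : (Site d → Fin d → (Matrix n n ℂ)ˣ) → Site d → ℕ → ℝ → ℝ → ℝ → Prop} (hGm : RadiiMono d G)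
    (hG : ∀ (U : Site d → Fin d → (Matrix n n ℂ)ˣ) (x : Site d) (K : ℕ) (α₀ α₁ α₂ : ℝ), 2 ≤ K → G U x K α₀ α₁ α₂ →
      ∃ (u : Site d → (Matrix n n ℂ)ˣ) (a : Site d → Fin d → Matrix n n ℂ),
        (∀ z, u z ∈ unitaryUnits (Matrix n n ℂ)) ∧
        (∀ (y : Site d) (τ : Fin d), l1 (y - x) ≤ 2 → ((gaugeAct u U y τ : (Matrix n n ℂ)ˣ) : Matrix n n ℂ) = exp (a y τ)) ∧
        (∀ (y : Site d) (τ : Fin d), l1 (y - x) ≤ 2 → ‖a y τ‖ ≤ α₀) ∧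
        (∀ (y : Site d) (τ i : Fin d), l1 (y - x) ≤ 1 → ‖fd i (fun z => a z τ) y‖ ≤ α₁))
    (C : B11Thm1.Consts) {k : ℕ} (hT : Thm1At C (torusVP d L N G (k + 1)))
    {ε₁ : ℝ} (hε₁ : 0 < ε₁) (hε₁a : ε₁ ≤ C.a₁) (hcube : cubeM L (k + 1) 2 ≤ C.Mfun ε₁)
    {V : Site d → Fin d → (Matrix n n ℂ)ˣ} (hV : V ∈ sfClass d L N ε₁ 0) :
    ∃ U : Site d → Fin d → (Matrix n n ℂ)ˣ, IsUnitaryCfg U ∧ avgIter L U (k + 1) = V ∧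
      SmallField U (2 * (C.B₃ * cubeM L (k + 1) 2 * ε₁ / ((L : ℝ) ^ (k + 1)) ^ 2)
        + expRem (4 * (C.B₃ * cubeM L (k + 1) 2 * ε₁ / (L : ℝ) ^ (k + 1)))) := by
  obtain ⟨⟨U, hUin, hUB, hUmin⟩, -, h910⟩ := hT ε₁ hε₁ hε₁a V hV
  have hUcl : U ∈ sfClass d L N (C.B₃ * ε₁) (k + 1) := hUin
  refine ⟨U, hUcl.1, hUB, smallField_of_localGauges hUcl.1 fun x => ?_⟩
  have hsizeM : (torusVP d L N G (k + 1)).sizeM (x, 2) ≤ C.Mfun ε₁ := hcube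
  have hreg : Regularity (torusVP d L N G (k + 1)) C.B₃ C.B₄ ε₁ U (x, 2) := h910 U hUmin _ hsizeM
  obtain ⟨u, a, hu, hexp, h0, h1⟩ := hG U x 2 _ _ _ le_rfl (gauge_of_regularity hGm hL hreg le_rfl)
  exact ⟨u, a, hu, hexp, h0, h1⟩

/-- **… AND THE DATUM'S PLAQUETTES.**  In the setting of `exists_smallField_cfg_of_thm1At_smallCube` with `L ≥ 2`, write `t = L^{k+1}`, `s = 5B₃ε₁`, `S = s(1 + 4s)`.  If `2s ≤ t`
(so that `ρ(4α₀) ≤ (4α₀)²`), the minimiser lies in the small-field class of radius `S∕t` at level `k+1` (`2α₁ + ρ(4α₀) ≤ (s + 4s²)∕t³`), and if moreover `16C₀S∕t ≤ 3`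
and `1024(d+1)(d+4)L²S∕t ≤ 1` (B7 Prop. 1∕2's transport regime), its `(k+1)`-fold block average — the DATUM `V` — has ALL plaquettes within `2S∕t` of `1`
(`MinimalActionCompact.avgIter_unitary_smallField`).  The datum was arbitrary in `sfClass d L N ε₁ 0`; `2S∕t → 0` as `k → ∞`. [folklore] -/
theorem smallField_datum_of_thm1At_smallCube [Nonempty n] {L N : ℕ} (hL : 2 ≤ L)
    {G : (Site d → Fin d → (Matrix n n ℂ)ˣ) → Site d → ℕ → ℝ → ℝ → ℝ → Prop} (hGm : RadiiMono d G)
    (hG : ∀ (U : Site d → Fin d → (Matrix n n ℂ)ˣ) (x : Site d) (K : ℕ) (α₀ α₁ α₂ : ℝ), 2 ≤ K → G U x K α₀ α₁ α₂ →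
      ∃ (u : Site d → (Matrix n n ℂ)ˣ) (a : Site d → Fin d → Matrix n n ℂ),
        (∀ z, u z ∈ unitaryUnits (Matrix n n ℂ)) ∧
        (∀ (y : Site d) (τ : Fin d), l1 (y - x) ≤ 2 → ((gaugeAct u U y τ : (Matrix n n ℂ)ˣ) : Matrix n n ℂ) = exp (a y τ)) ∧
        (∀ (y : Site d) (τ : Fin d), l1 (y - x) ≤ 2 → ‖a y τ‖ ≤ α₀) ∧
        (∀ (y : Site d) (τ i : Fin d), l1 (y - x) ≤ 1 → ‖fd i (fun z => a z τ) y‖ ≤ α₁))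
    (C : B11Thm1.Consts) {k : ℕ} (hT : Thm1At C (torusVP d L N G (k + 1)))
    {ε₁ : ℝ} (hε₁ : 0 < ε₁) (hε₁a : ε₁ ≤ C.a₁) (hcube : 5 / (2 * (L : ℝ) ^ (k + 1)) ≤ C.Mfun ε₁)
    (h2s : 2 * (5 * C.B₃ * ε₁) ≤ (L : ℝ) ^ (k + 1))
    (hC0 : 16 * C0 d * ((5 * C.B₃ * ε₁) * (1 + 4 * (5 * C.B₃ * ε₁)) / (L : ℝ) ^ (k + 1)) ≤ 3)
    (hwall : 1024 * (d + 1) * (d + 4) * (L : ℝ) ^ 2 * ((5 * C.B₃ * ε₁) * (1 + 4 * (5 * C.B₃ * ε₁)) / (L : ℝ) ^ (k + 1)) ≤ 1)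
    {V : Site d → Fin d → (Matrix n n ℂ)ˣ} (hV : V ∈ sfClass d L N ε₁ 0) :
    SmallField V (2 * ((5 * C.B₃ * ε₁) * (1 + 4 * (5 * C.B₃ * ε₁)) / (L : ℝ) ^ (k + 1))) := by
  have hL1 : 1 ≤ L := le_trans (by norm_num) hL
  have hL1r : (1 : ℝ) ≤ L := by exact_mod_cast hL1
  set t : ℝ := (L : ℝ) ^ (k + 1) with ht
  have ht1 : 1 ≤ t := one_le_pow₀ hL1r
  have ht0 : 0 < t := by linarith
  set s : ℝ := 5 * C.B₃ * ε₁ with hs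
  have hs0 : 0 < s := by have := C.B₃_pos; positivity
  set S : ℝ := s * (1 + 4 * s) with hS
  have hS0 : 0 < S := by positivity
  have hcubeM : cubeM L (k + 1) 2 = 5 / (2 * t) := by
    simp only [cubeM, ht]; norm_num
  have hcube' : cubeM L (k + 1) 2 ≤ C.Mfun ε₁ := by rw [hcubeM]; exact hcube
  obtain ⟨U, hUu, hUB, hUs⟩ := exists_smallField_cfg_of_thm1At_smallCube hL1 hGm hG C hT hε₁ hε₁a hcube' hV
  -- the common factor `c = s/(2t)` and the plaquette radius `≤ S/t³ = (S/t)/t²`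
  have hc : C.B₃ * cubeM L (k + 1) 2 * ε₁ = s / (2 * t) := by rw [hcubeM, hs]; field_simp
  rw [hc] at hUs
  have h4α : 4 * (s / (2 * t) / t) = 2 * s / t ^ 2 := by field_simp; ring
  have h2α : 2 * (s / (2 * t) / t ^ 2) = s / t ^ 3 := by field_simp
  rw [h4α, h2α] at hUs
  have hy0 : 0 ≤ 2 * s / t ^ 2 := by positivity
  have hy1 : 2 * s / t ^ 2 ≤ 1 := by
    rw [div_le_one (by positivity)]
    nlinarith
  have hrem : expRem (2 * s / t ^ 2) ≤ (2 * s / t ^ 2) ^ 2 := expRem_le_sq hy0 hy1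
  have hδ : s / t ^ 3 + expRem (2 * s / t ^ 2) ≤ (S / t) / t ^ 2 := by
    have e1 : (2 * s / t ^ 2) ^ 2 = 4 * s ^ 2 / t ^ 4 := by field_simp; ring
    have e2 : (S / t) / t ^ 2 = s / t ^ 3 + 4 * s ^ 2 / t ^ 3 := by rw [hS]; field_simp
    have h43 : 4 * s ^ 2 / t ^ 4 ≤ 4 * s ^ 2 / t ^ 3 :=
      div_le_div_of_nonneg_left (by positivity) (by positivity) (pow_le_pow_right₀ ht1 (by norm_num))
    rw [e2]; linarith
  have hUs' : SmallField U ((S / t) / ((L : ℝ) ^ (k + 1)) ^ 2) := MinimalActionRate.SmallField.mono hUs (by rw [← ht]; exact hδ)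
  -- B7 Prop. 1/2 transport of the radius through the `k+1` averaging steps
  have hδ0 : 0 ≤ S / t := by positivity
  have hav := (avgIter_unitary_smallField hL hUu hδ0 hC0 hwall hUs' (k + 1) 0 rfl).2
  rw [hUB] at hav
  refine MinimalActionRate.SmallField.mono hav ?_
  have hsimp : (S / t + 16 / 3 * C0 d * (S / t) ^ 2 * (1 / 4 : ℝ) ^ 0) / ((L : ℝ) ^ 0) ^ 2 = S / t + 16 / 3 * C0 d * (S / t) ^ 2 := by
    simp
  rw [hsimp]
  have hC0' : 16 / 3 * C0 d * (S / t) ≤ 1 := by nlinarith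
  nlinarith [mul_le_mul_of_nonneg_right hC0' hδ0]


/-! ## §2 A non-flat small datum in every rank: one twisted bond family -/

/-- `θ∕2 ≤ |e^{iθ} − 1|` for `0 ≤ θ ≤ 1` (`|e^{iθ} − 1| = 2 sin(θ∕2) ≥ 2θ∕π`). [folklore] -/
theorem half_le_norm_exp_I_mul_sub_one {θ : ℝ} (h0 : 0 ≤ θ) (h1 : θ ≤ 1) : θ / 2 ≤ ‖Complex.exp (Complex.I * θ) - 1‖ := by
  rw [Complex.norm_exp_I_mul_ofReal_sub_one]
  have hπ3 := Real.pi_gt_three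
  have hπ4 := Real.pi_le_four
  have hs : 2 / Real.pi * (θ / 2) ≤ Real.sin (θ / 2) := Real.mul_le_sin (by linarith) (by linarith)
  have h2 : 0 ≤ 2 / Real.pi * (θ / 2) := by positivity
  rw [Real.norm_eq_abs, abs_of_nonneg (by linarith)]
  have h3 : θ / 2 ≤ 2 * (2 / Real.pi * (θ / 2)) := by
    rw [show 2 * (2 / Real.pi * (θ / 2)) = 2 * θ / Real.pi by ring, le_div_iff₀ (by linarith)]
    nlinarith
  linarith

/-- **A NON-FLAT DATUM IN EVERY LEVEL-`0` SMALL-FIELD CLASS** (`d ≥ 2`, `N ≥ 2`, any `θ`): the `N`-periodic `U(N)`-valued unit-lattice configuration with the scalar phase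
`e^{iθ}·1` on the direction-`0` bonds based on the hyperplanes `N ∣ x₁` and `1` elsewhere lies in `sfClass d L N (4|θ|) 0` (every plaquette is a word of four bonds each within
`|e^{iθ} − 1| ≤ |θ|` of `1`), and its plaquette at the origin in the `(0,1)`-plane IS `e^{iθ}·1`, at distance EXACTLY `|e^{iθ} − 1|` (`≥ θ∕2` for `0 ≤ θ ≤ 1`) from `1`.
(The `θ = π` member is dag-n16-e's `−1` datum of `N16PinnedDataSmallField`.) [folklore] -/
theorem exists_twisted_datum [Nonempty n] (hd : 2 ≤ d) {N : ℕ} (hN : 2 ≤ N) (L : ℕ) (θ : ℝ) :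
    ∃ V : Site d → Fin d → (Matrix n n ℂ)ˣ, V ∈ sfClass d L N (4 * |θ|) 0 ∧
      ∃ (x : Site d) (κ κ' : Fin d), κ ≠ κ' ∧
        ‖((hol V x (plaqWord κ κ') : (Matrix n n ℂ)ˣ) : Matrix n n ℂ) - 1‖ = ‖Complex.exp (Complex.I * θ) - 1‖ := by
  classical
  set i₀ : Fin d := ⟨0, by omega⟩ with hi₀
  set i₁ : Fin d := ⟨1, by omega⟩ with hi₁
  have hne : i₀ ≠ i₁ := by simp [hi₀, hi₁, Fin.ext_iff]
  set g : ℂ := Complex.exp (Complex.I * θ) with hg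
  have hg0 : g ≠ 0 := Complex.exp_ne_zero _
  have hg1 : ‖g‖ = 1 := by rw [hg, mul_comm]; exact Complex.norm_exp_ofReal_mul_I θ
  -- the scalar unit `g • 1`: unitary, at distance `|g − 1| ≤ |θ|` from `1`
  set gU : (Matrix n n ℂ)ˣ := Units.map ((algebraMap ℂ (Matrix n n ℂ)).toMonoidHom) (Units.mk0 g hg0) with hgU
  have hgUval : ((gU : (Matrix n n ℂ)ˣ) : Matrix n n ℂ) = g • (1 : Matrix n n ℂ) := by
    rw [hgU, Units.coe_map]; exact Algebra.algebraMap_eq_smul_one g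
  have hconj : (starRingEnd ℂ) g * g = 1 := by rw [Complex.conj_mul', hg1]; simp
  have hconj' : g * (starRingEnd ℂ) g = 1 := by rw [Complex.mul_conj', hg1]; simp
  have hgUunit : gU ∈ unitaryUnits (Matrix n n ℂ) := by
    rw [mem_unitaryUnits, hgUval, Unitary.mem_iff, star_smul, star_one, smul_mul_smul_comm, smul_mul_smul_comm, mul_one,
      RCLike.star_def, hconj, hconj', one_smul]
    exact ⟨rfl, rfl⟩
  have hgUdev : ‖((gU : (Matrix n n ℂ)ˣ) : Matrix n n ℂ) - 1‖ = ‖g - 1‖ := by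
    rw [hgUval, show g • (1 : Matrix n n ℂ) - 1 = (g - 1) • (1 : Matrix n n ℂ) by rw [sub_smul, one_smul], norm_smul, norm_one, mul_one]
  have hdev_le : ‖g - 1‖ ≤ |θ| := by
    have h := Real.norm_exp_I_mul_ofReal_sub_one_le (x := θ)
    rwa [Real.norm_eq_abs] at h
  -- the configuration
  set V : Site d → Fin d → (Matrix n n ℂ)ˣ := fun x κ => if κ = i₀ ∧ (N : ℤ) ∣ x i₁ then gU else 1 with hV
  have hVunit : IsUnitaryCfg V := by
    intro x κ
    show (if κ = i₀ ∧ (N : ℤ) ∣ x i₁ then gU else 1) ∈ unitaryUnits (Matrix n n ℂ)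
    split_ifs
    · exact hgUunit
    · exact (unitaryUnits (Matrix n n ℂ)).one_mem
  have hV1 : ∀ x κ, V x κ ∈ U1 (Matrix n n ℂ) := fun x κ => mem_U1_of_unitary (hVunit x κ)
  have hVβ : ∀ x κ, ‖((V x κ : (Matrix n n ℂ)ˣ) : Matrix n n ℂ) - 1‖ ≤ |θ| := by
    intro x κ
    show ‖(((if κ = i₀ ∧ (N : ℤ) ∣ x i₁ then gU else 1 : (Matrix n n ℂ)ˣ)) : Matrix n n ℂ) - 1‖ ≤ |θ|
    split_ifs
    · rw [hgUdev]; exact hdev_le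
    · simp
  have hNP : ((N * L ^ 0 : ℕ) : ℤ) = (N : ℤ) := by simp
  refine ⟨V, ⟨hVunit, ?_, ?_⟩, 0, i₀, i₁, hne, ?_⟩
  · -- periodicity with the period of the level-0 class, `N·L⁰ = N`
    rw [hNP]
    intro x κ μ
    have hiff : (N : ℤ) ∣ (x + (N : ℤ) • e κ) i₁ ↔ (N : ℤ) ∣ x i₁ := by
      have h1 : (x + (N : ℤ) • e κ) i₁ = x i₁ + (N : ℤ) * e κ i₁ := by simp
      rw [h1]
      exact dvd_add_left (dvd_mul_right _ _)
    show (if μ = i₀ ∧ (N : ℤ) ∣ (x + (N : ℤ) • e κ) i₁ then gU else 1) = (if μ = i₀ ∧ (N : ℤ) ∣ x i₁ then gU else 1)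
    exact if_congr (Iff.rfl.and hiff) rfl rfl
  · -- every plaquette is a word of four bonds each within `|θ|` of `1`
    have h4 : (4 * |θ|) / ((L : ℝ) ^ 0) ^ 2 = 4 * |θ| := by simp
    rw [h4]
    intro x κ κ' _
    have h := norm_hol_sub_one_le_length_mul hV1 hVβ (plaqWord κ κ') x
    have hlen : ((plaqWord κ κ' : List (Letter d)).length : ℝ) = 4 := by simp [plaqWord]
    rwa [hlen] at h
  · -- the plaquette at the origin in the (i₀, i₁)-plane is the twisted bond itself
    have hN1 : ¬ ((N : ℤ) ∣ 1) := by
      intro h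
      have h' := Int.le_of_dvd one_pos h
      have : (2 : ℤ) ≤ N := by exact_mod_cast hN
      linarith
    have hV00 : V 0 i₀ = gU := by
      show (if i₀ = i₀ ∧ (N : ℤ) ∣ (0 : Site d) i₁ then gU else 1) = gU
      rw [if_pos ⟨rfl, by simp⟩]
    have hV1' : ∀ y : Site d, V y i₁ = 1 := fun y => by
      show (if i₁ = i₀ ∧ (N : ℤ) ∣ y i₁ then gU else 1) = 1
      rw [if_neg (fun h => hne h.1.symm)]
    have he1 : (e i₁ : Site d) i₁ = 1 := by simp [e_apply]
    have hVe1 : V (e i₁) i₀ = 1 := by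
      show (if i₀ = i₀ ∧ (N : ℤ) ∣ (e i₁ : Site d) i₁ then gU else 1) = 1
      rw [if_neg]
      rw [he1]
      exact fun h => hN1 h.2
    have hhol : hol V 0 (plaqWord i₀ i₁) = gU := by
      simp only [plaqWord, hol_cons, hol_nil, stepHol_true, stepHol_false, Letter.vec_true, Letter.vec_false, zero_add, mul_one]
      rw [show e i₀ + e i₁ - e i₀ = (e i₁ : Site d) by abel, show e i₀ + e i₁ + -e i₀ - e i₁ = (0 : Site d) by abel,
        hV00, hV1', hVe1, hV1']
      simp
    rw [hhol, hgUdev]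

/-! ## §3 THE VACUITY IN EVERY RANK: Theorem 1 at the torus instances fails at every deep level -/

/-- **★ AT A DEEP LEVEL, THEOREM 1 AT THE TORUS INSTANCE IS FALSE (given the interface binders).**  `d ≥ 2`, `L ≥ 2`, `N ≥ 2`, `U(N)` with `N ≥ 1`; `G` with `hGm`∕`hG` as in
`N16H7OfReg9` §3; `C : B11Thm1.Consts`.  Write `t = L^{k+1}`, `s = 5B₃a₁`, `S = s(1+4s)`, `θ = min(a₁∕4, 1)`.  If the level is deep enough that (h₁) the five-site cube fits
Theorem 1's bound at `ε₁ = a₁` (`5∕(2t) ≤ M(a₁)`), (h₂) `2s ≤ t`, (h₃) `16C₀S∕t ≤ 3`, (h₄) `1024(d+1)(d+4)L²S∕t ≤ 1`, (h₅) `2S∕t < θ∕2`, then `¬ Thm1At C (torusVP d L N G (k+1))`: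
by §2 every datum of `sfClass d L N a₁ 0` would have all plaquettes within `2S∕t` of `1`, but §3's twisted datum (phase `e^{iθ}`, in the class since `4θ ≤ a₁`) has one at
distance `≥ θ∕2 > 2S∕t`.  WHAT FAILS IS THE PAIR (leaf-06's reading `Reg910` of (9)–(10) over ALL lattice cubes with the bound `B₃·sizeM·ε₁` proportional to the cube's own size
parameter, divergence D-s3-3 of `MinimalActionDictionary`) + (the extraction interface `hG`): on the five-site cube the printed-shape bound is a factor `L^{−(k+1)}` below the
class radius.  PRINT is not contradicted: Bałaban's cubes are unions of big blocks, `M ∈ R₁M₁ℕ`, `M ≥ R₁M₁` ([Balaban1985Variational] p. 279; D-s3-3's own gloss), and the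
parent's §3 reads Theorem 1 only on cubes with `cubeM ∈ [2, 7∕2]`. [cite: Balaban1985Variational, Thm 1 (8)–(10) p.279] -/
theorem not_thm1At_torusVP_of_deep [Nonempty n] (hd : 2 ≤ d) {L N : ℕ} (hL : 2 ≤ L) (hN : 2 ≤ N)
    {G : (Site d → Fin d → (Matrix n n ℂ)ˣ) → Site d → ℕ → ℝ → ℝ → ℝ → Prop} (hGm : RadiiMono d G)
    (hG : ∀ (U : Site d → Fin d → (Matrix n n ℂ)ˣ) (x : Site d) (K : ℕ) (α₀ α₁ α₂ : ℝ), 2 ≤ K → G U x K α₀ α₁ α₂ →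
      ∃ (u : Site d → (Matrix n n ℂ)ˣ) (a : Site d → Fin d → Matrix n n ℂ),
        (∀ z, u z ∈ unitaryUnits (Matrix n n ℂ)) ∧
        (∀ (y : Site d) (τ : Fin d), l1 (y - x) ≤ 2 → ((gaugeAct u U y τ : (Matrix n n ℂ)ˣ) : Matrix n n ℂ) = exp (a y τ)) ∧
        (∀ (y : Site d) (τ : Fin d), l1 (y - x) ≤ 2 → ‖a y τ‖ ≤ α₀) ∧
        (∀ (y : Site d) (τ i : Fin d), l1 (y - x) ≤ 1 → ‖fd i (fun z => a z τ) y‖ ≤ α₁))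
    (C : B11Thm1.Consts) {k : ℕ}
    (h₁ : 5 / (2 * (L : ℝ) ^ (k + 1)) ≤ C.Mfun C.a₁)
    (h₂ : 2 * (5 * C.B₃ * C.a₁) ≤ (L : ℝ) ^ (k + 1))
    (h₃ : 16 * C0 d * ((5 * C.B₃ * C.a₁) * (1 + 4 * (5 * C.B₃ * C.a₁)) / (L : ℝ) ^ (k + 1)) ≤ 3)
    (h₄ : 1024 * (d + 1) * (d + 4) * (L : ℝ) ^ 2 * ((5 * C.B₃ * C.a₁) * (1 + 4 * (5 * C.B₃ * C.a₁)) / (L : ℝ) ^ (k + 1)) ≤ 1)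
    (h₅ : 2 * ((5 * C.B₃ * C.a₁) * (1 + 4 * (5 * C.B₃ * C.a₁)) / (L : ℝ) ^ (k + 1)) < min (C.a₁ / 4) 1 / 2) :
    ¬ Thm1At C (torusVP d L N G (k + 1)) := by
  intro hT
  have ha₁ := C.a₁_pos
  set θ : ℝ := min (C.a₁ / 4) 1 with hθ
  have hθ0 : 0 ≤ θ := le_min (by linarith) zero_le_one
  have hθ1 : θ ≤ 1 := min_le_right _ _
  have hθa : 4 * |θ| ≤ C.a₁ := by rw [abs_of_nonneg hθ0]; have := min_le_left (C.a₁ / 4) 1; linarith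
  obtain ⟨V, hV, x, κ, κ', hκ, hplaq⟩ := exists_twisted_datum (n := n) hd hN L θ
  have hV' : V ∈ sfClass d L N C.a₁ 0 := MinimalActionDictionary.sfClass_mono hθa hV
  have hsmall := smallField_datum_of_thm1At_smallCube hL hGm hG C hT ha₁ le_rfl h₁ h₂ h₃ h₄ hV'
  have hup := hsmall x κ κ' hκ
  rw [hplaq] at hup
  have hlow := half_le_norm_exp_I_mul_sub_one hθ0 hθ1
  linarith

/-- **★★ FROM SOME LEVEL ON, EVERY TORUS INSTANCE OF THEOREM 1 IS FALSE (given the interface binders)**: `∃ k₀, ∀ k ≥ k₀, ¬ Thm1At C (torusVP d L N G (k+1))` — the five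
thresholds of `not_thm1At_torusVP_of_deep` hold as soon as `L^{k+1}` exceeds an explicit constant in `d, L, a₁, B₃, M(a₁)` (Archimedes, `L ≥ 2`).  Consequently the hypothesis
pair «`hG` ∧ `∀ k, Thm1At C (torusVP d L N G (k+1))`» displayed by the parent's §3 `leafH3sup_loose_of_thm1At_torusVP` and by every Thm-1-keyed N16 producer downstream of it
is UNINHABITED (A6: those theorems are VACUOUS AS TYPED; see `not_forall_thm1At_torusVP_rankN`).  Nothing of Bałaban is refuted: the defect is the cube family of leaf-06's dictionary
(D-s3-3), not Theorem 1. [folklore] -/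
theorem exists_forall_not_thm1At_torusVP [Nonempty n] (hd : 2 ≤ d) {L N : ℕ} (hL : 2 ≤ L) (hN : 2 ≤ N)
    {G : (Site d → Fin d → (Matrix n n ℂ)ˣ) → Site d → ℕ → ℝ → ℝ → ℝ → Prop} (hGm : RadiiMono d G)
    (hG : ∀ (U : Site d → Fin d → (Matrix n n ℂ)ˣ) (x : Site d) (K : ℕ) (α₀ α₁ α₂ : ℝ), 2 ≤ K → G U x K α₀ α₁ α₂ →
      ∃ (u : Site d → (Matrix n n ℂ)ˣ) (a : Site d → Fin d → Matrix n n ℂ),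
        (∀ z, u z ∈ unitaryUnits (Matrix n n ℂ)) ∧
        (∀ (y : Site d) (τ : Fin d), l1 (y - x) ≤ 2 → ((gaugeAct u U y τ : (Matrix n n ℂ)ˣ) : Matrix n n ℂ) = exp (a y τ)) ∧
        (∀ (y : Site d) (τ : Fin d), l1 (y - x) ≤ 2 → ‖a y τ‖ ≤ α₀) ∧
        (∀ (y : Site d) (τ i : Fin d), l1 (y - x) ≤ 1 → ‖fd i (fun z => a z τ) y‖ ≤ α₁))
    (C : B11Thm1.Consts) :
    ∃ k₀ : ℕ, ∀ k : ℕ, k₀ ≤ k → ¬ Thm1At C (torusVP d L N G (k + 1)) := by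
  have ha₁ := C.a₁_pos
  have hB₃ := C.B₃_pos
  have hM := C.Mfun_pos C.a₁ ha₁
  have hC0 := C0_pos d
  have hL1r : (1 : ℝ) < L := by exact_mod_cast hL
  set s : ℝ := 5 * C.B₃ * C.a₁ with hs
  have hs0 : 0 < s := by positivity
  set S : ℝ := s * (1 + 4 * s) with hS
  have hS0 : 0 < S := by positivity
  set θ : ℝ := min (C.a₁ / 4) 1 with hθ
  have hθ0 : 0 < θ := lt_min (by linarith) one_pos
  set A : ℝ := 1024 * (d + 1) * (d + 4) * (L : ℝ) ^ 2 with hA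
  have hA0 : 0 < A := by positivity
  -- one bound above all five thresholds
  have hp1 : 0 ≤ 5 / (2 * C.Mfun C.a₁) := by positivity
  have hp3 : 0 ≤ 16 * C0 d * S / 3 := by positivity
  have hp4 : 0 ≤ A * S := by positivity
  have hp5 : 0 ≤ 4 * S / θ := by positivity
  obtain ⟨m, hm⟩ := pow_unbounded_of_one_lt (5 / (2 * C.Mfun C.a₁) + 2 * s + 16 * C0 d * S / 3 + A * S + 4 * S / θ) hL1r
  refine ⟨m, fun k hk => ?_⟩
  set t : ℝ := (L : ℝ) ^ (k + 1) with ht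
  have hmt : (L : ℝ) ^ m ≤ t := pow_le_pow_right₀ hL1r.le (by omega)
  have hBt := hm.trans_le hmt
  have ht0 : 0 < t := by positivity
  have hB1 : 5 / (2 * C.Mfun C.a₁) < t := by linarith
  have hB2 : 2 * s ≤ t := by linarith
  have hB3 : 16 * C0 d * S / 3 < t := by linarith
  have hB4 : A * S < t := by linarith
  have hB5 : 4 * S / θ < t := by linarith
  refine not_thm1At_torusVP_of_deep hd hL hN hGm hG C ?_ ?_ ?_ ?_ ?_
  · -- (h₁) the five-site cube fits `M(a₁)`
    rw [div_le_iff₀ (by positivity)]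
    rw [div_lt_iff₀ (by positivity)] at hB1
    linarith
  · exact hB2
  · -- (h₃)
    rw [show 16 * C0 d * (S / t) = (16 * C0 d * S) / t by ring, div_le_iff₀ ht0]
    rw [div_lt_iff₀ (by norm_num : (0:ℝ) < 3)] at hB3
    linarith
  · -- (h₄)
    rw [show A * (S / t) = (A * S) / t by ring, div_le_iff₀ ht0]
    linarith
  · -- (h₅)
    rw [show 2 * (S / t) = (2 * S) / t by ring, div_lt_iff₀ ht0]
    rw [div_lt_iff₀ hθ0] at hB5
    nlinarith

/-- **★★ `¬ ∀ k, Thm1At C (torusVP d L N G (k+1))` under the interface binders** — the hypothesis block ⟨`hGm`, `hG`, `hT`⟩ of `N16H7OfReg9.leafH3sup_loose_of_thm1At_torusVP` (and of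
its `h7Shape` form, and of every theorem that carries the same three binders: `…N16H7TightWindow`, `…N16H7NoBinding` §4–§5, `…N16H7LooseOfThm1At`, `…N16InteriorOfCapture` §2–§4,
`…N16PinnedLayer13CoPH` §4 `exists_letters_n16HolderAtReading_loose_of_h5_thm1At`, `…N16PinnedLooseMatch`, `…N16LettersOfLettersB9SrcAllTorus` ∕ `…PinnedLooseMatchOfLettersB9Src`
Thm-1-keyed rows, the evidence file `N16DischargeTestV5`'s `stub_thm1At` as keyed there) is JOINTLY UNSATISFIABLE for `d ≥ 2`, `L ≥ 2`, `N ≥ 2`: those theorems are VACUOUS AS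
TYPED (A6).  REPAIR (planner's ∕ leaf-06's word, not done here): restrict `torusVP`'s Theorem-1 cube family to print's class — cubes of size parameter at least one big block
(`sizeM c ≥ 1`, or `M ∈ R₁M₁ℕ`) — under which the parent's §3 (cube `cubeM ∈ [2, 7∕2]`) goes through verbatim and this file's §2 does not apply. [folklore] -/
theorem not_forall_thm1At_torusVP_rankN [Nonempty n] (hd : 2 ≤ d) {L N : ℕ} (hL : 2 ≤ L) (hN : 2 ≤ N)
    {G : (Site d → Fin d → (Matrix n n ℂ)ˣ) → Site d → ℕ → ℝ → ℝ → ℝ → Prop} (hGm : RadiiMono d G)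
    (hG : ∀ (U : Site d → Fin d → (Matrix n n ℂ)ˣ) (x : Site d) (K : ℕ) (α₀ α₁ α₂ : ℝ), 2 ≤ K → G U x K α₀ α₁ α₂ →
      ∃ (u : Site d → (Matrix n n ℂ)ˣ) (a : Site d → Fin d → Matrix n n ℂ),
        (∀ z, u z ∈ unitaryUnits (Matrix n n ℂ)) ∧
        (∀ (y : Site d) (τ : Fin d), l1 (y - x) ≤ 2 → ((gaugeAct u U y τ : (Matrix n n ℂ)ˣ) : Matrix n n ℂ) = exp (a y τ)) ∧
        (∀ (y : Site d) (τ : Fin d), l1 (y - x) ≤ 2 → ‖a y τ‖ ≤ α₀) ∧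
        (∀ (y : Site d) (τ i : Fin d), l1 (y - x) ≤ 1 → ‖fd i (fun z => a z τ) y‖ ≤ α₁))
    (C : B11Thm1.Consts) : ¬ ∀ k : ℕ, Thm1At C (torusVP d L N G (k + 1)) := by
  intro h
  obtain ⟨k₀, hk₀⟩ := exists_forall_not_thm1At_torusVP hd hL hN hGm hG C
  exact hk₀ k₀ le_rfl (h k₀)

end

end Summit.QuantumFields.YangMills.BalabanUVNodes.N16Thm1AtTorusVPSmallCubesRankN
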